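import Summits.AnomalousDissipation.AnomalousDissipation.Theorems.MarginalStabilityChainBurgersLayerKHStubVolterra
import Summits.AnomalousDissipation.AnomalousDissipation.Theorems.MarginalStabilityChainBurgersLayerKHStubRayleighJost
import Summits.AnomalousDissipation.AnomalousDissipation.Theorems.MarginalStabilityChainBurgersLayerKHStubSheetLimit
import Summits.AnomalousDissipation.AnomalousDissipation.Theorems.MarginalStabilityChainBurgersLayerKHStubResolvent
import Summits.AnomalousDissipation.AnomalousDissipation.Theorems.MarginalStabilityChainBurgersLayerKHStubResolventUnique
import Summits.AnomalousDissipation.AnomalousDissipation.Theorems.MarginalStabilityChainBurgersLayerKHStubStrained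
import Summits.AnomalousDissipation.AnomalousDissipation.Theorems.MarginalStabilityChainBurgersLayerKHStubModeZero

/-!
-- LINE `Sketch` — CLOSED SKELETON (no stubs left): every `stub_*` of the registered skeleton is a landed theorem;
-- the tree copy of the closing theorem is `Theorems/MarginalStabilityChainBurgersLayerKH.lean` (p93650), `Sheet.burgersLayerKH_proof`.

# The crux `MarginalStabilityChain.BurgersLayerKH` (stmt-AnomalousDissipation-3008): ν-uniform
# Kelvin–Helmholtz instability of the exact Burgers vortex layer

`burgersLayerKH_proof : BurgersLayerKH` — there are `Re₂` and `c₀ > 0` such that for every `Re ≥ Re₂` the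
linearised stretched-vorticity operator about the erf layer `U(y) = ∫₀ʸ e^{-s²/2} ds`,
`σω = -iαRe(Uω + U''ψ) + ω + yω' + ω'' - α²ω`, `ω = -(ψ'' - α²ψ)`, has a Gaussian-class eigenmode
(`ψ ∈ C⁴`, `ψ ≢ 0`, `ψ → 0` at `±∞`, `|ω| ≤ Ce^{-y²/4}`) with `re σ ≥ c₀·Re`.

This is the sorry-free composition (`Sheet.BurgersLayerKH_of`, Line file
`MarginalStabilityChainBurgersLayerKHLine`) of the seven registered stubs of the line `Sketch`
(lead prover-line-stmt-AnomalousDissipation-3008-0, 2026-08-16): two-parameter unfolding of the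
Kelvin–Helmholtz mode from the explicit Helmholtz vortex-sheet dispersion function
`(λ² - U₊²)/(λ² + U₊²)`, `U₊ = √(π/2)` — `α → 0` (`SheetLimit.stub_sheetLimit`, with
`Volterra.stub_volterra`, `RayleighJost.stub_rayleighJost`) and `h = 1/(αRe) → 0`
(`Strained.stub_strained`, with the `h`-uniform Gaussian-class resolvent `Resolvent.stub_resolventExists`
and its uniqueness `ResolventUnique.stub_resolventUnique`) — then Brouwer's fixed point theorem for
the Newton map on the disc `|λ - U₊| ≤ U₊/4` and `ModeZero.stub_modeOfZero`.  The witness has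
`α = α₀` fixed small, `Re₂ = 1/(α₀h₀)`, `c₀ = 3α₀U₊/4`.

References: Beronov–Kida, Phys. Fluids 8 (1996) 1024 (numerics of exactly this operator);
Drazin–Reid, *Hydrodynamic Stability* (2nd ed. 2004) §23 (long-wave limit); route file
`Theses/MarginalStabilityChain.lean`, item 3008; `Cruxes/BurgersLayerKH/PICKED.md`, `Lines/Sketch.lean`.
-/

set_option linter.dupNamespace false

namespace Summit.AnomalousDissipation.AnomalousDissipation.Theorems.BurgersLayerKH.Sheet.Lines.Sketch
open Summit.AnomalousDissipation.AnomalousDissipation.Theorems.BurgersLayerKH.Sheet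

/-- **ν-uniform Kelvin–Helmholtz instability of the exact Burgers vortex layer** (the crux
`BurgersLayerKH` of the route `MarginalStabilityChain`, by name): composition of the seven landed stubs
of the line `Sketch` through `BurgersLayerKH_of`. [folklore] -/
theorem line_Sketch_closed : Summit.AnomalousDissipation.AnomalousDissipation.Theses.MarginalStabilityChain.BurgersLayerKH :=
  BurgersLayerKH_of Volterra.stub_volterra RayleighJost.stub_rayleighJost SheetLimit.stub_sheetLimit
    Resolvent.stub_resolventExists ResolventUnique.stub_resolventUnique Strained.stub_strained
    ModeZero.stub_modeOfZero

end Summit.AnomalousDissipation.AnomalousDissipation.Theorems.BurgersLayerKH.Sheet.Lines.Sketch
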